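import Literature.AlgebraicGeometry.Motives.DeRhamComparisonFrolicherFiniteProofs
import Literature.NumberTheory.Transcendental.KaehlerHodgeEllipticRepresentativeProofs
import Literature.Geometry.Kaehler.TorusDolbeaultRegularityPq
import HarnessLib

/-!
# The Frölicher inequality `dim H^k_dR(M; ℂ) ≤ ∑ h^{p,q}` reduced to Warner's analytic theorems
# 6.5 and 6.6 for `Δ_∂̄`

The named fact `Literature.AlgebraicGeometry.Motives.finrank_complexDeRham_le_sum_hodgeNumber`
(`DeRhamComparison.lean`; C. Voisin, *Hodge Theory and Complex Algebraic Geometry I* (2002),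
§8.3.3, proof of Thm. 8.28, pp. 204–205) is `finrank_complexDeRham_le_sum_hodgeNumber_of_finite`
(the Frölicher spectral-sequence inequality, proved in the tree) fed with Cartan–Serre finiteness
`Literature.NumberTheory.Transcendental.finite_dolbeaultCohomology`, and the latter is reduced in
`KaehlerHodgeEllipticRepresentativeProofs.lean` (Voisin, Thm. 5.24 / Cor. 5.25 from Thm. 5.22) to
F. W. Warner's Theorems 6.5 (regularity of weak solutions) and 6.6 (compactness) for the elliptic
operator `Δ_∂̄` on the Hermitian inner product spaces `A^{p,q}(M)` of smooth `(p,q)`-forms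
(*Foundations of Differentiable Manifolds and Lie Groups*, GTM 94 (1983), pp. 222–224). This file
records the composite:

* `finrank_complexDeRham_le_sum_hodgeNumber_of_regularity_of_compactness` —
  **`finrank_complexDeRham_le_sum_hodgeNumber E M` from 6.5 and 6.6 for `Δ_∂̄` on every
  `A^{p,q}(M)`** (for every `C^∞` metric and orientation family on `M`; the proof uses a Hermitian
  one), the hypotheses spelled exactly as in
  `Literature.NumberTheory.Transcendental.finite_dolbeaultCohomology_of_regularity_of_compactness`.

No named fact is introduced; what separates this theorem from an unconditional discharge
`finrank_complexDeRham_le_sum_hodgeNumber_holds` is precisely the elliptic theory of Warner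
§§6.29–6.33 / Voisin Thm. 5.22 for `Δ_∂̄`.

## References

* C. Voisin, *Hodge Theory and Complex Algebraic Geometry I* (2002), §8.3.3 (proof of Thm. 8.28),
  §5.3.1 (Thm. 5.24, Cor. 5.25), §5.2.3 (Thm. 5.22). [cite: VoisinHodgeI2002, §8.3.3, proof of Thm. 8.28]
* F. W. Warner, *Foundations of Differentiable Manifolds and Lie Groups*, GTM 94 (1983), 6.5, 6.6.
-/

noncomputable section

open scoped Manifold ContDiff ComplexInnerProductSpace
open Module Bundle
open Literature.Geometry.Kaehler Literature.NumberTheory.Transcendental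

namespace Literature.AlgebraicGeometry.Motives

variable (E : Type) [NormedAddCommGroup E] [NormedSpace ℂ E]
  (M : Type) [TopologicalSpace M] [ChartedSpace E M]
  [IsManifold 𝓘(ℂ, E) ω M] [IsManifold 𝓘(ℝ, E) ∞ M]

/-- **The Frölicher inequality `dim_ℂ H^k_dR(M; ℂ) ≤ ∑_{p+q=k} h^{p,q}(M)` for compact complex `M`
(the named fact `finrank_complexDeRham_le_sum_hodgeNumber E M`; Voisin (2002), §8.3.3, proof of
Thm. 8.28) from Warner's Theorems 6.5 and 6.6 for `Δ_∂̄` on the spaces `A^{p,q}(M)`** (assumed for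
every finite-dimensional structure, `C^∞` metric `g` and orientation family `o`, as in
`finite_dolbeaultCohomology_of_regularity_of_compactness`): Cartan–Serre finiteness from the two
analytic theorems, then the spectral-sequence inequality
`finrank_complexDeRham_le_sum_hodgeNumber_of_finite`.
[cite: VoisinHodgeI2002, §8.3.3, proof of Thm. 8.28] -/
theorem finrank_complexDeRham_le_sum_hodgeNumber_of_regularity_of_compactness
    (hC : ∀ [FiniteDimensional ℂ E] {n : ℕ} [Fact (finrank ℝ E = n)]
      (g : ContMDiffRiemannianMetric 𝓘(ℝ, E) ∞ E (fun x : M ↦ TangentSpace 𝓘(ℝ, E) x))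
      (o : (x : M) → Orientation ℝ (TangentSpace 𝓘(ℝ, E) x) (Fin n)) {m : ℕ}
      [MeasurableSpace E] [BorelSpace E] [CompactSpace M] [T2Space M]
      (hJ : letI : RiemannianBundle (fun x : M ↦ TangentSpace 𝓘(ℝ, E) x) := ⟨g.toRiemannianMetric⟩
        ∀ (x : M) (v w : TangentSpace 𝓘(ℝ, E) x),
          inner ℝ (tangentJ E x v) (tangentJ E x w) = inner ℝ v w)
      (p q : ℕ) (h : (p + q) + m = n)
      (ho : letI : RiemannianBundle (fun x : M ↦ TangentSpace 𝓘(ℝ, E) x) := ⟨g.toRiemannianMetric⟩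
        IsSmoothForm (riemannianVolumeForm o)),
      letI : RiemannianBundle (fun x : M ↦ TangentSpace 𝓘(ℝ, E) x) := ⟨g.toRiemannianMetric⟩
      haveI : IsContMDiffRiemannianBundle 𝓘(ℝ, E) ∞ E (fun x : M ↦ TangentSpace 𝓘(ℝ, E) x) :=
        ⟨g.inner, g.contMDiff, fun _ _ _ ↦ rfl⟩
      haveI : Fact (IsSmoothForm (riemannianVolumeForm o)) := ⟨ho⟩
      ∀ (u : ℕ → CL2SmoothForms.pq o p q) (c : ℝ), (∀ i, ‖u i‖ ≤ c) →
        (∀ i, ‖CL2SmoothForms.pqLaplacian o hJ p q h (u i)‖ ≤ c) →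
          ∃ φ : ℕ → ℕ, StrictMono φ ∧ CauchySeq (u ∘ φ))
    (hR : ∀ [FiniteDimensional ℂ E] {n : ℕ} [Fact (finrank ℝ E = n)]
      (g : ContMDiffRiemannianMetric 𝓘(ℝ, E) ∞ E (fun x : M ↦ TangentSpace 𝓘(ℝ, E) x))
      (o : (x : M) → Orientation ℝ (TangentSpace 𝓘(ℝ, E) x) (Fin n)) {m : ℕ}
      [MeasurableSpace E] [BorelSpace E] [CompactSpace M] [T2Space M]
      (hJ : letI : RiemannianBundle (fun x : M ↦ TangentSpace 𝓘(ℝ, E) x) := ⟨g.toRiemannianMetric⟩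
        ∀ (x : M) (v w : TangentSpace 𝓘(ℝ, E) x),
          inner ℝ (tangentJ E x v) (tangentJ E x w) = inner ℝ v w)
      (p q : ℕ) (h : (p + q) + m = n)
      (ho : letI : RiemannianBundle (fun x : M ↦ TangentSpace 𝓘(ℝ, E) x) := ⟨g.toRiemannianMetric⟩
        IsSmoothForm (riemannianVolumeForm o)),
      letI : RiemannianBundle (fun x : M ↦ TangentSpace 𝓘(ℝ, E) x) := ⟨g.toRiemannianMetric⟩
      haveI : IsContMDiffRiemannianBundle 𝓘(ℝ, E) ∞ E (fun x : M ↦ TangentSpace 𝓘(ℝ, E) x) :=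
        ⟨g.inner, g.contMDiff, fun _ _ _ ↦ rfl⟩
      haveI : Fact (IsSmoothForm (riemannianVolumeForm o)) := ⟨ho⟩
      ∀ (α : CL2SmoothForms.pq o p q) (ℓ : CL2SmoothForms.pq o p q →L[ℂ] ℂ),
        (∀ φ, ℓ (CL2SmoothForms.pqLaplacian o hJ p q h φ) = ⟪α, φ⟫) →
          ∃ w : CL2SmoothForms.pq o p q, ∀ φ, ℓ φ = ⟪w, φ⟫) :
    finrank_complexDeRham_le_sum_hodgeNumber E M := by
  -- tactic mode on purpose: a term-mode proof would implicit-lambda the fact's own instance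
  -- binders into the statement next to the section instances (overlapping instances)
  intro _ _ _ _ _ k
  exact finrank_complexDeRham_le_sum_hodgeNumber_of_finite E M
    (finite_dolbeaultCohomology_of_regularity_of_compactness hC hR) k


/-! ## The discharge: Warner's Theorems 6.6 and 6.5 for `Δ_∂̄` on `A^{p,q}(M)` -/

/-- **Warner's Theorem 6.6 (compactness) for `Δ_∂̄` on every `A^{p,q}(M)`**, in the exact shape of
the hypothesis `hC` of `finrank_complexDeRham_le_sum_hodgeNumber_of_regularity_of_compactness`
(`CL2SmoothForms.pq_compact`: Fourier–lattice Rellich theorem transported through holomorphic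
charts, Warner 6.29–6.33 for the `∂̄`-Laplacian). [cite: WarnerGTM94, Thm. 6.6] -/
theorem pq_compact_of_contMDiffRiemannianMetric :
    ∀ [FiniteDimensional ℂ E] {n : ℕ} [Fact (finrank ℝ E = n)]
      (g : ContMDiffRiemannianMetric 𝓘(ℝ, E) ∞ E (fun x : M ↦ TangentSpace 𝓘(ℝ, E) x))
      (o : (x : M) → Orientation ℝ (TangentSpace 𝓘(ℝ, E) x) (Fin n)) {m : ℕ}
      [MeasurableSpace E] [BorelSpace E] [CompactSpace M] [T2Space M]
      (hJ : letI : RiemannianBundle (fun x : M ↦ TangentSpace 𝓘(ℝ, E) x) := ⟨g.toRiemannianMetric⟩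
        ∀ (x : M) (v w : TangentSpace 𝓘(ℝ, E) x),
          inner ℝ (tangentJ E x v) (tangentJ E x w) = inner ℝ v w)
      (p q : ℕ) (h : (p + q) + m = n)
      (ho : letI : RiemannianBundle (fun x : M ↦ TangentSpace 𝓘(ℝ, E) x) := ⟨g.toRiemannianMetric⟩
        IsSmoothForm (riemannianVolumeForm o)),
      letI : RiemannianBundle (fun x : M ↦ TangentSpace 𝓘(ℝ, E) x) := ⟨g.toRiemannianMetric⟩
      haveI : IsContMDiffRiemannianBundle 𝓘(ℝ, E) ∞ E (fun x : M ↦ TangentSpace 𝓘(ℝ, E) x) :=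
        ⟨g.inner, g.contMDiff, fun _ _ _ ↦ rfl⟩
      haveI : Fact (IsSmoothForm (riemannianVolumeForm o)) := ⟨ho⟩
      ∀ (u : ℕ → CL2SmoothForms.pq o p q) (c : ℝ), (∀ i, ‖u i‖ ≤ c) →
        (∀ i, ‖CL2SmoothForms.pqLaplacian o hJ p q h (u i)‖ ≤ c) →
          ∃ φ : ℕ → ℕ, StrictMono φ ∧ CauchySeq (u ∘ φ) := by
  intro _ n _ g o m _ _ _ _ hJ p q h ho
  letI : RiemannianBundle (fun x : M ↦ TangentSpace 𝓘(ℝ, E) x) := ⟨g.toRiemannianMetric⟩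
  haveI : IsContMDiffRiemannianBundle 𝓘(ℝ, E) ∞ E (fun x : M ↦ TangentSpace 𝓘(ℝ, E) x) :=
    ⟨g.inner, g.contMDiff, fun _ _ _ ↦ rfl⟩
  haveI : Fact (IsSmoothForm (riemannianVolumeForm o)) := ⟨ho⟩
  exact fun u c hb hΔ ↦ CL2SmoothForms.pq_compact o hJ p q h u c hb hΔ

/-- **Warner's Theorem 6.5 (regularity of weak solutions) for `Δ_∂̄` on every `A^{p,q}(M)`**, in the
exact shape of the hypothesis `hR` of
`finrank_complexDeRham_le_sum_hodgeNumber_of_regularity_of_compactness` (`CL2SmoothForms.pq_regular`: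
Warner 6.32 on the Fourier lattice, transported through holomorphic charts, glued by a partition of
unity and restricted to the type `(p,q)`). [cite: WarnerGTM94, Thm. 6.5] -/
theorem pq_regular_of_contMDiffRiemannianMetric :
    ∀ [FiniteDimensional ℂ E] {n : ℕ} [Fact (finrank ℝ E = n)]
      (g : ContMDiffRiemannianMetric 𝓘(ℝ, E) ∞ E (fun x : M ↦ TangentSpace 𝓘(ℝ, E) x))
      (o : (x : M) → Orientation ℝ (TangentSpace 𝓘(ℝ, E) x) (Fin n)) {m : ℕ}
      [MeasurableSpace E] [BorelSpace E] [CompactSpace M] [T2Space M]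
      (hJ : letI : RiemannianBundle (fun x : M ↦ TangentSpace 𝓘(ℝ, E) x) := ⟨g.toRiemannianMetric⟩
        ∀ (x : M) (v w : TangentSpace 𝓘(ℝ, E) x),
          inner ℝ (tangentJ E x v) (tangentJ E x w) = inner ℝ v w)
      (p q : ℕ) (h : (p + q) + m = n)
      (ho : letI : RiemannianBundle (fun x : M ↦ TangentSpace 𝓘(ℝ, E) x) := ⟨g.toRiemannianMetric⟩
        IsSmoothForm (riemannianVolumeForm o)),
      letI : RiemannianBundle (fun x : M ↦ TangentSpace 𝓘(ℝ, E) x) := ⟨g.toRiemannianMetric⟩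
      haveI : IsContMDiffRiemannianBundle 𝓘(ℝ, E) ∞ E (fun x : M ↦ TangentSpace 𝓘(ℝ, E) x) :=
        ⟨g.inner, g.contMDiff, fun _ _ _ ↦ rfl⟩
      haveI : Fact (IsSmoothForm (riemannianVolumeForm o)) := ⟨ho⟩
      ∀ (α : CL2SmoothForms.pq o p q) (ℓ : CL2SmoothForms.pq o p q →L[ℂ] ℂ),
        (∀ φ, ℓ (CL2SmoothForms.pqLaplacian o hJ p q h φ) = ⟪α, φ⟫) →
          ∃ w : CL2SmoothForms.pq o p q, ∀ φ, ℓ φ = ⟪w, φ⟫ := by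
  intro _ n _ g o m _ _ _ _ hJ p q h ho
  letI : RiemannianBundle (fun x : M ↦ TangentSpace 𝓘(ℝ, E) x) := ⟨g.toRiemannianMetric⟩
  haveI : IsContMDiffRiemannianBundle 𝓘(ℝ, E) ∞ E (fun x : M ↦ TangentSpace 𝓘(ℝ, E) x) :=
    ⟨g.inner, g.contMDiff, fun _ _ _ ↦ rfl⟩
  haveI : Fact (IsSmoothForm (riemannianVolumeForm o)) := ⟨ho⟩
  exact fun α ℓ hw ↦ CL2SmoothForms.pq_regular o hJ p q h α ℓ hw

omit [IsManifold 𝓘(ℂ, E) ω M] [IsManifold 𝓘(ℝ, E) ∞ M] in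
/-- **The Frölicher inequality `dim_ℂ H^k_dR(M; ℂ) ≤ ∑_{p+q=k} h^{p,q}(M)` for compact complex
manifolds** — discharge of the named fact `finrank_complexDeRham_le_sum_hodgeNumber E M`
(C. Voisin, *Hodge Theory and Complex Algebraic Geometry I* (2002), §8.3.3, proof of Thm. 8.28,
pp. 204–205: degeneration-free spectral-sequence inequality from the finiteness of Dolbeault
cohomology, Cor. 5.25, itself from the elliptic theory of `Δ_∂̄`, Thm. 5.22), obtained by feeding
`finrank_complexDeRham_le_sum_hodgeNumber_of_regularity_of_compactness` with Warner's Theorems 6.6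
and 6.5 for `Δ_∂̄` proved in `Literature/Geometry/Kaehler/TorusDolbeault*.lean`.
[cite: VoisinHodgeI2002, §8.3.3, proof of Thm. 8.28, pp. 204–205] -/
theorem finrank_complexDeRham_le_sum_hodgeNumber_holds : finrank_complexDeRham_le_sum_hodgeNumber E M := by
  exact finrank_complexDeRham_le_sum_hodgeNumber_of_regularity_of_compactness E M
    (pq_compact_of_contMDiffRiemannianMetric E M) (pq_regular_of_contMDiffRiemannianMetric E M)

end Literature.AlgebraicGeometry.Motives
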